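import Summits.AtomisticToContinuum.HydrodynamicLimit.Theorems.EnergyActivityTails.Negative.ExpMomentLattice

/-!
# Negative knowledge for the crux `OneFlightGossipEngine.EnergyActivityTails` (stmt-AtomisticToContinuum-17703):
# the EXPONENTIAL-MOMENT (large-deviation) strengthening of its equilibrium rung is FALSE — part 2,
# the Gibbs lower bound on the labelled events, the refutation for every energy-dominating summand, instances

Continuation of `ExpMomentLattice.lean` (`ExpMomentTailsOf`, `IsEnergyDominating`, pointwise bounds); see its header
for the mechanism.  From the standing disprover's workfile `Cruxes/EnergyActivityTails/Disproof.lean` §3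
(refuter-cdisprove-stmt-AtomisticToContinuum-17703-0, cycle 1).  Nothing here asserts a Theses declaration.

* `lintegralF_tail_ge` — `(N+1)! · e^{Fmin N kw β 1} · evB ≤ ∫ exp(B Σₚ aₚ𝟙{aₚ>V}) dG_N` for the `F`-activity;
* `expMomentTailsOf_false` — `IsEnergyDominating F → ¬ ExpMomentTailsOf F` (`β = 2`, `ε = 1`, `τ = t⁴`,
  `σ = (4/5)/l²`, `N + 1 = (l n)³`; the 13733 `final_ineq` at `β = 1`, `Z = 1`);
* `EnergyActivityTailsExpMoment` (the crux's energy summand verbatim) and `energyActivityTailsExpMoment_false` — THE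
  negative lemma of this crux: the LD currency of the ENERGY-activity tail is false already at global equilibrium;
* `transferActivityTailsExpMoment_false'` — TwoClocks' landed `transferActivityTailsExpMoment_false` (16624) re-derived
  as the instance `F = transfer` (the energy statement is the STRONGER negative: `energy ≤ transfer` record-wise and
  the tail functional is monotone, so `ExpMoment(transfer) ⇒ ExpMoment(energy)`).

MORAL for the dock (`ClampedTransferDockOfInputs` consumes EAT = input (iv) SEPARATELY from CAT): the energy half of
the transfer-clamp price can only be asked in MEAN (`L¹`); at `s > 0` it can NOT be transferred from ANY equilibrium
statement about this functional through the entropy inequality `E_λ[X] ≤ γ⁻¹(H(λ|G) + log E_G e^{γX})`,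
`H ≤ κ(N+1)` — that needs `log E_G exp(γ(N+1)·tail) = o(N+1)` at a fixed tilt, i.e. `ExpMomentTailsOf energy`,
false at every `β > 0`, every level `V`, all large `τ`.  Under the crux's own `L¹` currency the relay event has
Gibbs weight `e^{−C(N+1)log(tl)}` and contributes `→ 0`: this kills the LD CURRENCY, not the crux.
-/

noncomputable section

open Real MeasureTheory
open scoped InnerProductSpace

namespace Summit.AtomisticToContinuum.HydrodynamicLimit.Theorems

namespace EnergyActivityTailsNegative

open Literature.Analysis.FluidPDE Literature.Analysis.FunctionSpaces Literature.MathematicalPhysics.KineticTheory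
open EquilibriumClampedCollisionalWindowLDNegative EquilibriumClampedCollisionalWindowLDNegative.Lat
open TransferActivityTailsNegative (gRec gRec_nonneg gRec_ge ε_eq_κw)

section Lattice

variable {Λ : EquilibriumClampedCollisionalWindowLDNegative.Lat} {N : ℕ} {a : Fin (N + 1) ≃ Λ.Slot}
variable {Φ : HardSphereFlow (Torus.geometry (Fin 3)) Λ.P.ε (N + 1)}

/-- **The main lower bound for the exponential moment of the `F`-tail sum**:
`(N+1)! · e^{Fmin N kw β 1} · evB ≤ ∫ exp(B Σₚ aₚ𝟙{aₚ>V}) dG_N`. -/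
theorem lintegralF_tail_ge (hcardN : Fintype.card Λ.Slot = N + 1) (hW : Λ.WinOK) (hG : Λ.GainOK)
    (hε : Λ.P.ε < 1 / 2) (hr : Λ.P.r < 1 / 2) (hw0 : 0 < Λ.w) {σ : ℝ} (hσ : σ ≤ 1 / 2)
    (hεσ : hsDiameter σ N = Λ.P.ε)
    (hgoodP : localGibbsMeasure σ (fun _ => 1) (fun _ => 0) (fun _ => (1 : ℝ)) N Φ.goodᶜ = 0)
    {F : Fin (N + 1) → Rec N → ℝ} (hF0 : ∀ p c, 0 ≤ F p c)
    (hFE : ∀ p (c : Rec N), c.fst = p → energyImpulse c ≤ F p c)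
    {κ V β B : ℝ} (hκ : 0 ≤ κ) (hV : V < κ * gRec Λ.P) (hβ : 0 ≤ β) (hB : 2 * β ≤ B) (hκε : Λ.P.ε ≤ κ * Λ.w)
    {kw : ℕ} (hkK : kw + 1 ≤ Λ.P.K) (hkw : (kw : ℝ) * Λ.P.θhi ≤ Λ.w) (hM : 24 * Λ.m ≤ Λ.M) :
    ENNReal.ofReal (((N + 1).factorial : ℝ) * Real.exp (Λ.Fmin N kw β 1) * Λ.evB N) ≤
      ∫⁻ z, ENNReal.ofReal (Real.exp (B * ∑ p : Fin (N + 1),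
          Set.indicator {y : ℝ | V < y} (fun y => y) (actF Λ Φ F κ p z)))
        ∂(localGibbsMeasure σ (fun _ => 1) (fun _ => 0) (fun _ => (1 : ℝ)) N) := by
  classical
  set P := localGibbsMeasure σ (fun _ => 1) (fun _ => 0) (fun _ => (1 : ℝ)) N with hP
  set f : Cfg N → ENNReal := fun z => ENNReal.ofReal (Real.exp (B * ∑ p : Fin (N + 1),
      Set.indicator {y : ℝ | V < y} (fun y => y) (actF Λ Φ F κ p z)))
  set c : ENNReal := ENNReal.ofReal (Real.exp (Λ.Fmin N kw β 1)) with hc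
  -- Step 1: restrict to the disjoint union of the labelled events
  have hmeas : ∀ a : Fin (N + 1) ≃ Λ.Slot, MeasurableSet (Λ.Ev a : Set (Cfg N)) := fun a => measurableSet_Ev
  have hdisj : Pairwise (Function.onFun Disjoint fun a : Fin (N + 1) ≃ Λ.Slot => (Λ.Ev a : Set (Cfg N))) :=
    fun a a' h => Ev_disjoint hW h
  have step1 : ∑ a : Fin (N + 1) ≃ Λ.Slot, ∫⁻ z in Λ.Ev a, f z ∂P ≤ ∫⁻ z, f z ∂P := by
    have h := lintegral_iUnion (μ := P) hmeas hdisj f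
    rw [tsum_fintype] at h
    rw [← h]
    exact setLIntegral_le_lintegral _ _
  -- Step 2: on each event the integrand is at least `c` off the null set `goodᶜ`
  have step2 : ∀ a : Fin (N + 1) ≃ Λ.Slot, c * P (Λ.Ev a) ≤ ∫⁻ z in Λ.Ev a, f z ∂P := by
    intro a
    have hpt : ∀ z ∈ Λ.Ev a, (Φ.good).indicator (fun _ => c) z ≤ f z := by
      intro z hz
      by_cases hg : z ∈ Φ.good
      · rw [Set.indicator_of_mem hg]
        exact ENNReal.ofReal_le_ofReal (Real.exp_le_exp.2
          (exponentF_ge_tail hW hG hε hw0 hz hg hF0 hFE hκ hV hβ hB hκε hkK hkw hM))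
      · rw [Set.indicator_of_notMem hg]; exact bot_le
    calc c * P (Λ.Ev a) ≤ c * P (Φ.good ∩ Λ.Ev a) := by
          refine mul_le_mul' le_rfl ?_
          have hsub : (Λ.Ev a : Set (Cfg N)) ⊆ (Φ.good ∩ Λ.Ev a) ∪ Φ.goodᶜ := by
            intro z hz; by_cases hg : z ∈ Φ.good
            · exact Or.inl ⟨hg, hz⟩
            · exact Or.inr hg
          calc P (Λ.Ev a) ≤ P ((Φ.good ∩ Λ.Ev a) ∪ Φ.goodᶜ) := measure_mono hsub
            _ ≤ P (Φ.good ∩ Λ.Ev a) + P Φ.goodᶜ := measure_union_le _ _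
            _ = P (Φ.good ∩ Λ.Ev a) := by rw [hgoodP, add_zero]
      _ = ∫⁻ z in Λ.Ev a, (Φ.good).indicator (fun _ => c) z ∂P := by
          rw [lintegral_indicator_const Φ.measurableSet_good, Measure.restrict_apply Φ.measurableSet_good]
      _ ≤ ∫⁻ z in Λ.Ev a, f z ∂P := setLIntegral_mono' (hmeas a) hpt
  -- Step 3: the uniform measure bound and the count of labellings
  have step3 : ∀ a : Fin (N + 1) ≃ Λ.Slot, c * ENNReal.ofReal (Λ.evB N) ≤ c * P (Λ.Ev a) := fun a =>
    mul_le_mul' le_rfl (measure_Ev_ge (a := a) hW hσ hεσ hr)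
  have hcardE : Fintype.card (Fin (N + 1) ≃ Λ.Slot) = (N + 1).factorial := by
    have e : Fin (N + 1) ≃ Λ.Slot := Fintype.equivOfCardEq (by rw [Fintype.card_fin, hcardN])
    rw [Fintype.card_equiv e, Fintype.card_fin]
  calc ENNReal.ofReal (((N + 1).factorial : ℝ) * Real.exp (Λ.Fmin N kw β 1) * Λ.evB N)
      = ((N + 1).factorial : ENNReal) * (c * ENNReal.ofReal (Λ.evB N)) := by
        rw [ENNReal.ofReal_mul (by positivity), ENNReal.ofReal_mul (by positivity), ENNReal.ofReal_natCast, hc,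
          mul_assoc]
    _ = ∑ _a : Fin (N + 1) ≃ Λ.Slot, c * ENNReal.ofReal (Λ.evB N) := by
        rw [Finset.sum_const, Finset.card_univ, hcardE, nsmul_eq_mul]
    _ ≤ ∑ a : Fin (N + 1) ≃ Λ.Slot, ∫⁻ z in Λ.Ev a, f z ∂P :=
        Finset.sum_le_sum fun a _ => (step3 a).trans (step2 a)
    _ ≤ _ := step1

end Lattice

/-! ## The refutation of the strengthening, for every energy-dominating summand -/

/-- **The exponential-moment strengthening of the equilibrium `F`-activity tails is false for every nonnegative
summand `F` dominating the energy impulse on its own records**, by the frozen line-lattice Newton-cradle witness of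
the 13733 refutation: equilibrium data `a₀ = θ₀ = 1, u₀ = 0`, `σ = (4/5)/l²`, `V = max V₀ 1`, `β = 2`, `ε = 1`,
`τ = t⁴`, `N + 1 = (l n)³`; every receiving sphere of the relay carries ENERGY activity `≥ (9/100) t²/l² > V`, so
`2 Σᵢ aᵢ𝟙{aᵢ>V}` dominates the 13733 exponent at `Z = 1` and the 13733 final inequality applies verbatim. -/
theorem expMomentTailsOf_false {F : (N : ℕ) → Fin (N + 1) → Rec N → ℝ} (hF : IsEnergyDominating F) :
    ¬ ExpMomentTailsOf F := by
  classical
  intro H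
  obtain ⟨hF0, hFE⟩ := hF
  obtain ⟨σ₀, hσ₀, H⟩ := H 1 1 (0 : V3) one_pos one_pos
  -- the packing fraction `σ = (4/5)/l²`
  obtain ⟨l, hl, hlσ⟩ : ∃ l : ℕ, 2 ≤ l ∧ (4 / 5 : ℝ) / (l : ℝ) ^ 2 < σ₀ := by
    refine ⟨⌈1 / σ₀⌉₊ + 2, by omega, ?_⟩
    have h1 : 1 / σ₀ ≤ ⌈1 / σ₀⌉₊ := Nat.le_ceil _
    have hl2 : (1 / σ₀ : ℝ) + 2 ≤ ((⌈1 / σ₀⌉₊ + 2 : ℕ) : ℝ) := by push_cast; linarith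
    have hpos : 0 < 1 / σ₀ := by positivity
    set L : ℝ := ((⌈1 / σ₀⌉₊ + 2 : ℕ) : ℝ)
    have hL : 1 / σ₀ < L := by linarith
    have hL1 : 1 ≤ L := by linarith
    rw [div_lt_iff₀ (by positivity)]
    have : 1 < σ₀ * L := by rwa [div_lt_iff₀' hσ₀] at hL
    nlinarith
  set σ : ℝ := (4 / 5) / (l : ℝ) ^ 2 with hσdef
  have hl0 : (0 : ℝ) < l := by exact_mod_cast (show 0 < l by omega)
  have hl2 : (2 : ℝ) ≤ l := by exact_mod_cast hl
  have hσ : 0 < σ := by positivity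
  have hσ5 : σ ≤ 1 / 5 := by
    rw [hσdef, div_le_iff₀ (by positivity)]; nlinarith
  have hσ2 : σ < 1 / 2 := by linarith
  specialize H σ hσ hlσ (flowFam hσ hσ2)
  obtain ⟨V₀, hV₀, H⟩ := H
  specialize H (max V₀ 1) (le_max_left _ _) 2 two_pos 1 one_pos
  obtain ⟨τ₀, hτ₀, H⟩ := H
  -- the choice of `t` (`τ = t⁴`)
  obtain ⟨t, ht, hτt, hbig, htV⟩ : ∃ t : ℕ, 24 * l ^ 2 ≤ t ∧ τ₀ ≤ (t : ℝ) ^ 4 ∧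
      39 * (l : ℝ) ^ 2 * (224 + 6 * l + 40 * 1 * |(1 : ℝ) - 1|) ≤ 1 * t ∧ max V₀ 1 < t := by
    set X : ℝ := 39 * (l : ℝ) ^ 2 * (224 + 6 * l) with hX
    refine ⟨⌈τ₀⌉₊ + 24 * l ^ 2 + ⌈X⌉₊ + ⌈max V₀ 1⌉₊ + 1, by omega, ?_, ?_, ?_⟩
    · have h1 : τ₀ ≤ ⌈τ₀⌉₊ := Nat.le_ceil _
      have h2 : (⌈τ₀⌉₊ : ℝ) ≤ ((⌈τ₀⌉₊ + 24 * l ^ 2 + ⌈X⌉₊ + ⌈max V₀ 1⌉₊ + 1 : ℕ) : ℝ) := by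
        exact_mod_cast (by omega)
      have h3 : (1 : ℝ) ≤ ((⌈τ₀⌉₊ + 24 * l ^ 2 + ⌈X⌉₊ + ⌈max V₀ 1⌉₊ + 1 : ℕ) : ℝ) := by
        exact_mod_cast (by omega)
      calc τ₀ ≤ ((⌈τ₀⌉₊ + 24 * l ^ 2 + ⌈X⌉₊ + ⌈max V₀ 1⌉₊ + 1 : ℕ) : ℝ) := h1.trans h2
        _ = ((⌈τ₀⌉₊ + 24 * l ^ 2 + ⌈X⌉₊ + ⌈max V₀ 1⌉₊ + 1 : ℕ) : ℝ) ^ 1 := (pow_one _).symm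
        _ ≤ _ := pow_le_pow_right₀ h3 (by norm_num)
    · have h1 : X ≤ ⌈X⌉₊ := Nat.le_ceil _
      have h2 : (⌈X⌉₊ : ℝ) ≤ ((⌈τ₀⌉₊ + 24 * l ^ 2 + ⌈X⌉₊ + ⌈max V₀ 1⌉₊ + 1 : ℕ) : ℝ) := by
        exact_mod_cast (by omega)
      rw [sub_self, abs_zero, mul_zero, add_zero, one_mul]
      exact h1.trans h2
    · have h1 : max V₀ 1 ≤ ⌈max V₀ 1⌉₊ := Nat.le_ceil _
      have h2 : ((⌈max V₀ 1⌉₊ + 1 : ℕ) : ℝ) ≤ ((⌈τ₀⌉₊ + 24 * l ^ 2 + ⌈X⌉₊ + ⌈max V₀ 1⌉₊ + 1 : ℕ) : ℝ) := by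
        exact_mod_cast (by omega)
      push_cast at h2 ⊢
      linarith
  specialize H ((t : ℝ) ^ 4) hτt
  obtain ⟨N₀, H⟩ := H
  -- the choice of `n` and `N + 1 = (l n)³`
  set n : ℕ := N₀ + 18 * t ^ 7 * l ^ 2 + 10 with hn
  have hn2 : 2 ≤ n := by omega
  have hn1 : 1 ≤ n := by omega
  set N : ℕ := (l * n) ^ 3 - 1 with hNdef
  have hln : 1 ≤ l * n := Nat.mul_pos (by omega) (by omega)
  have hN : N + 1 = (l * n) ^ 3 := by
    have : 1 ≤ (l * n) ^ 3 := Nat.one_le_pow _ _ hln; omega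
  have hN₀ : N₀ ≤ N := by
    have h1 : l * n ≤ (l * n) ^ 3 := by
      calc l * n = (l * n) ^ 1 := (pow_one _).symm
        _ ≤ (l * n) ^ 3 := Nat.pow_le_pow_right hln (by norm_num)
    have h2 : n ≤ l * n := Nat.le_mul_of_pos_left n (by omega)
    omega
  have hE := H N hN₀
  -- the lattice
  set Λ := LatW' l n t with hΛ
  have hΛeq : Λ = LatW l n t := LatW'_eq hl hn1
  have hcard : Fintype.card Λ.Slot = N + 1 := by rw [hΛeq, LatW.card_slot, hN]
  have hchart : 4 * (6 * (t : ℝ) ^ 7 * (l : ℝ) ^ 2 + 4) ≤ (l : ℝ) ^ 3 * n := by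
    have hn' : ((18 * t ^ 7 * l ^ 2 + 10 : ℕ) : ℝ) ≤ n := by exact_mod_cast (by omega)
    push_cast at hn'
    have hl8 : (8 : ℝ) ≤ (l : ℝ) ^ 3 := by
      have := pow_le_pow_left₀ (by norm_num : (0:ℝ) ≤ 2) hl2 3; norm_num at this; exact this
    have h0 : (0 : ℝ) ≤ (t : ℝ) ^ 7 * (l : ℝ) ^ 2 := by positivity
    have h1 : (8 : ℝ) * n ≤ (l : ℝ) ^ 3 * n := mul_le_mul_of_nonneg_right hl8 (by positivity)
    nlinarith
  have hW : Λ.WinOK := by rw [hΛeq]; exact LatW.winOK hl ht hn1 hchart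
  have hG : Λ.GainOK := by rw [hΛeq]; exact LatW.gainOK hl ht hn1
  obtain ⟨hε12, hr12, -⟩ : Λ.P.ε < 1 / 2 ∧ Λ.P.r < 1 / 2 ∧ (4 / 5 : ℝ) / (l : ℝ) ^ 2 ≤ 1 / 2 := by
    rw [hΛeq]; exact LatW.small_facts hl ht hn1
  have hT := bpar.Tpos hl ht
  have hc := LatW.c_pos (l := l) (n := n) hl hn1
  have hw0 : 0 < Λ.w := by show 0 < cscale l n * ((t : ℝ) ^ 4 * (l : ℝ) ^ 2); positivity
  have hεσ : hsDiameter σ N = Λ.P.ε := rfl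
  have hgoodP : localGibbsMeasure σ (fun _ => 1) (fun _ => 0) (fun _ => (1 : ℝ)) N (flowFam hσ hσ2 N).goodᶜ = 0 :=
    localGibbsMeasure_absolutelyContinuous σ _ _ _ N (flowFam hσ hσ2 N) (flowFam hσ hσ2 N).measure_compl_good
  have hκ : 0 ≤ σ / (t : ℝ) ^ 4 := by positivity
  -- the activity floor beats the level
  have hVlt : max V₀ 1 < σ / (t : ℝ) ^ 4 * gRec Λ.P := by
    rw [hΛeq]
    have hg := gRec_ge (l := l) (n := n) (t := t) hl ht hn2
    have ht' : ((24 * l ^ 2 : ℕ) : ℝ) ≤ t := by exact_mod_cast ht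
    push_cast at ht'
    have h1 : σ / (t : ℝ) ^ 4 * ((9 / 80 : ℝ) * (t : ℝ) ^ 6) ≤ σ / (t : ℝ) ^ 4 * gRec (LatW l n t).P :=
      mul_le_mul_of_nonneg_left hg hκ
    have h2 : σ / (t : ℝ) ^ 4 * ((9 / 80 : ℝ) * (t : ℝ) ^ 6) = (9 / 100) * (t : ℝ) ^ 2 / (l : ℝ) ^ 2 := by
      rw [hσdef]; field_simp; ring
    have h3 : (t : ℝ) < (9 / 100) * (t : ℝ) ^ 2 / (l : ℝ) ^ 2 := by
      rw [lt_div_iff₀ (by positivity)]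
      nlinarith
    linarith
  have hκε : Λ.P.ε ≤ σ / (t : ℝ) ^ 4 * Λ.w := by
    rw [hΛeq, hσdef]; exact le_of_eq (ε_eq_κw (n := n) hl ht)
  obtain ⟨-, -, -, w4, w5, -⟩ := bpar.win_facts hl ht
  have hkK : 4 * t ^ 7 * l ^ 2 + 1 ≤ Λ.P.K := by rw [hΛeq]; exact w5
  have hkw : ((4 * t ^ 7 * l ^ 2 : ℕ) : ℝ) * Λ.P.θhi ≤ Λ.w := by
    rw [hΛeq, LatW.P_eq, Params.scale_θhi _ hc.ne', LatW.w_eq]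
    calc ((4 * t ^ 7 * l ^ 2 : ℕ) : ℝ) * (cscale l n * (bpar l t).θhi)
        = cscale l n * (((4 * t ^ 7 * l ^ 2 : ℕ) : ℝ) * (bpar l t).θhi) := by ring
      _ ≤ cscale l n * ((t : ℝ) ^ 4 * (l : ℝ) ^ 2) := mul_le_mul_of_nonneg_left w4 hc.le
  have hM : 24 * Λ.m ≤ Λ.M := by
    show 24 * (6 * t ^ 7 * l ^ 2 + 3) ≤ l ^ 3 * n
    have hl8 : 8 ≤ l ^ 3 := by
      calc 8 = 2 ^ 3 := by norm_num
        _ ≤ l ^ 3 := Nat.pow_le_pow_left hl 3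
    have hn' : 18 * t ^ 7 * l ^ 2 + 10 ≤ n := by omega
    calc 24 * (6 * t ^ 7 * l ^ 2 + 3) = 8 * (18 * t ^ 7 * l ^ 2 + 9) := by ring
      _ ≤ l ^ 3 * n := Nat.mul_le_mul hl8 (by omega)
  -- the main bound and the final inequality
  have key := lintegralF_tail_ge (Λ := Λ) (Φ := flowFam hσ hσ2 N) hcard hW hG hε12 hr12 hw0 (by linarith) hεσ
    hgoodP (F := F N) (hF0 N) (hFE N) (V := max V₀ 1) (β := 1) (B := 2) hκ hVlt zero_le_one (by norm_num) hκε
    hkK hkw hM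
  have hfin := LatW.final_ineq hl ht hn2 hN one_pos 1 hbig
  rw [← hΛeq] at hfin
  have hlt : ENNReal.ofReal (Real.exp (1 * ((N : ℝ) + 1))) <
      ENNReal.ofReal (((N + 1).factorial : ℝ) * Real.exp (Λ.Fmin N (4 * t ^ 7 * l ^ 2) 1 1) * Λ.evB N) := by
    rw [one_mul, ENNReal.ofReal_lt_ofReal_iff (lt_trans (Real.exp_pos _) hfin)]
    exact hfin
  -- identify the statement's integral with ours
  have hw : (t : ℝ) ^ 4 * ((N : ℝ) + 1) ^ (-(1 / 3 : ℝ)) = Λ.w := by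
    rw [LatW.w_eq_stmt (t := t) hl hn1 hN, hΛeq]
  rw [localGibbsLaw_eq, hw] at hE
  exact absurd (lt_of_lt_of_le hlt (key.trans hE)) (lt_irrefl _)

/-! ## Instances: the crux's energy summand (THE negative lemma of 17703) and TwoClocks' transfer summand -/

/-- The crux's energy summand, verbatim: `|‖v⁺‖² − ‖v⁻‖²|/2` on the records of particle `i`, `0` else. -/
def energySummand (N : ℕ) (i : Fin (N + 1)) (c : Rec N) : ℝ :=
  if c.fst = i then |‖c.postVel.1‖ ^ 2 - ‖c.preVel.1‖ ^ 2| / 2 else 0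

/-- The energy summand is energy-dominating (with equality on its own records). -/
theorem isEnergyDominating_energySummand : IsEnergyDominating energySummand := by
  refine ⟨fun N i c => ?_, fun N i c h => ?_⟩
  · unfold energySummand; split_ifs <;> positivity
  · unfold energySummand energyImpulse; rw [if_pos h]

/-- **Exponential-moment (LD) strengthening of the equilibrium rung of the crux `EnergyActivityTails`** (NOT the
crux; its summand, window and scale verbatim, constant profiles, canonical Gibbs law):
`∃V₀ ∀V ≥ V₀ ∀β > 0 ∀ε > 0 ∃τ₀ ∀τ ≥ τ₀ ∃N₀ ∀N ≥ N₀`, `∫ exp(β Σᵢ aᵉᵢ𝟙{aᵉᵢ > V}) dG_N ≤ exp(ε(N+1))`. -/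
def EnergyActivityTailsExpMoment : Prop :=
  ∀ (a₀ θ₀ : ℝ) (u₀ : V3), 0 < a₀ → 0 < θ₀ → ∃ σ₀ : ℝ, 0 < σ₀ ∧ ∀ σ : ℝ, 0 < σ → σ < σ₀ →
    ∀ Φ : (N : ℕ) → HardSphereFlow (Torus.geometry (Fin 3)) (hsDiameter σ N) (N + 1),
    ∃ V₀ : ℝ, 0 < V₀ ∧ ∀ V : ℝ, V₀ ≤ V → ∀ β : ℝ, 0 < β → ∀ ε : ℝ, 0 < ε →
    ∃ τ₀ : ℝ, 0 < τ₀ ∧ ∀ τ : ℝ, τ₀ ≤ τ → ∃ N₀ : ℕ, ∀ N : ℕ, N₀ ≤ N →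
      ∫⁻ z, ENNReal.ofReal (Real.exp (β * ∑ i : Fin (N + 1),
          Set.indicator {y : ℝ | V < y} (fun y => y)
            (σ / τ * (Φ N).collisionSum (Set.Ioc 0 (τ * ((N : ℝ) + 1) ^ (-(1 / 3 : ℝ))))
              (fun c => if c.fst = i then |‖c.postVel.1‖ ^ 2 - ‖c.preVel.1‖ ^ 2| / 2 else 0) z)))
        ∂(localGibbsLaw σ (fun _ => a₀) (fun _ => u₀) (fun _ => θ₀) N (Φ N)) ≤
        ENNReal.ofReal (Real.exp (ε * ((N : ℝ) + 1)))

/-- Read-back: the typed strengthening IS `ExpMomentTailsOf energySummand` (definitional). -/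
theorem energyActivityTailsExpMoment_iff : EnergyActivityTailsExpMoment ↔ ExpMomentTailsOf energySummand :=
  Iff.rfl

/-- **THE negative lemma of stmt-17703: the exponential-moment (LD) strengthening of the equilibrium energy-activity
tails is FALSE** (Newton-cradle relay; see the module docstring).  The crux itself (an `L¹` statement) is untouched. -/
theorem energyActivityTailsExpMoment_false : ¬ EnergyActivityTailsExpMoment :=
  fun h => expMomentTailsOf_false isEnergyDominating_energySummand (energyActivityTailsExpMoment_iff.1 h)

/-- TwoClocks' transfer summand `‖Δvᵢ‖ + |Δ‖vᵢ‖²|/2` (stmt-16624) is energy-dominating. -/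
theorem isEnergyDominating_transferSummand :
    IsEnergyDominating (fun (N : ℕ) (i : Fin (N + 1)) (c : Rec N) =>
      if c.fst = i then ‖c.postVel.1 - c.preVel.1‖ + |‖c.postVel.1‖ ^ 2 - ‖c.preVel.1‖ ^ 2| / 2 else 0) := by
  refine ⟨fun N i c => ?_, fun N i c h => ?_⟩
  · dsimp only; split_ifs <;> positivity
  · dsimp only; unfold energyImpulse; rw [if_pos h]
    exact le_add_of_nonneg_left (norm_nonneg _)

/-- The landed `TransferActivityTailsNegative.transferActivityTailsExpMoment_false` (TwoClocks' 16624, p127643)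
re-derived as the instance `F = transfer` of `expMomentTailsOf_false` — the energy lemma is the stronger negative. -/
theorem transferActivityTailsExpMoment_false' : ¬ TransferActivityTailsNegative.TransferActivityTailsExpMoment :=
  fun h => expMomentTailsOf_false isEnergyDominating_transferSummand h

end EnergyActivityTailsNegative

end Summit.AtomisticToContinuum.HydrodynamicLimit.Theorems

end
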